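import Summits.ResolutionOfSingularities.ResolutionOfSingularities.Theorems.DeltaCutStellarLow
import Summits.ResolutionOfSingularities.ResolutionOfSingularities.Theorems.DeltaCutStellarJetInhabitant
import Summits.ResolutionOfSingularities.ResolutionOfSingularities.Theorems.DeltaCutStellarLatJ

/-!
# StellarCut R22c — «LowResidue»: the KERNEL INHABITANT at a COMPOSITE MARKING — `x₀⁴ + x₁⁵x₂` over `𝔽₂`, marking `4`
# (lens-6 «barrier-complement carving», g36 door 3)

In T19d's model `S = 𝔽₂[x₀, x₁, x₂]_{(x₀,x₁,x₂)}`, `Xs = Spec S`, frame members `D j = (x j)~`, `H = D 0`: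

* `res = (0, 5, 1)`, `fR = x₀⁴ + x₁⁵·x₂`, `MR = (fR~, 4)` — characteristic `p = 2`, marking `n = 4 = 2·2` (COMPOSITE), labels of
  residues `5 % 4 = 1 < 2` and `1 % 4 = 1 < 2`: ★ `ncHypShapeLow_res : ncHypShapeLow 2 4 Xs (frame res) H MR` (R22a's class), with
  `res_nondegenerate` (s.n.c. frame through `H`, the closed point of order `4` lying on ALL THREE members — the label clauses at `D 1`,
  `D 2` are exercised, not escaped) and ★★ `weakResolution_res` BY THE LOW-RESIDUE LIST LAW (R22a `ncHypShapeLow.exists_weakResolution`).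
* cn42 — KERNEL NON-MEMBERSHIP in every previously decided class, on the nose: `not_ncHypShapeCop_res`, `not_ncHypShapeJet_res`,
  `not_ncHypShapeLat_res`, `not_ncHypShapeLatJ_res` (each of T18/T19/L20/J21's classes records `M.mult = q` with `q` PRIME; here
  `M.mult = 4`), `not_ncHypShapeLow_res_of_prime` (the low-residue class at a prime marking), and `not_ncHypShape_res` (T10's tame class
  needs `4` a unit in the stalks; `4 = 2·2 = 0`).  So the datum lies in the cell `WORNCHypWildLow 4`'s class and in NO cell decided before.

The support computation uses the derivation `∂/∂x₂` (`∂fR/∂x₂ = x₁⁵`): `fR ∈ 𝔪_𝔭⁴ ⊆ 𝔪_𝔭² ⇒ x₁⁵ ∈ 𝔭 ⇒ x₀⁴ = fR − x₁⁵x₂ ∈ 𝔭`.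
Cell-level (`IsBase`-) inhabitation of `WORNCHypWildLow 4` is NOT claimed (no concrete `IsBase` instance in the tree; debt (d) of the
critic's ledger stays owed at 0) — this is the LIST-LEVEL inhabitant of the class the cell's bridge produces.

0 sorry; axioms standard. [new] [cite: Kollar2007, (3.111) Step 3] [cite: Hauser2010, §5]
-/

noncomputable section

open CategoryTheory CategoryTheory.Limits AlgebraicGeometry TopologicalSpace IsLocalRing
open Literature.AlgebraicGeometry.Resolution

namespace Summit.ResolutionOfSingularities.ResolutionOfSingularities.Theorems.DeltaCutClasses

open Summit.ResolutionOfSingularities.ResolutionOfSingularities.Theorems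
open WeakOrderReduction ForcedTowerClasses

namespace JetModel

/-! ## The datum `x₀⁴ + x₁⁵x₂` on the frame `(V(x₀); x₁ : 5, x₂ : 1)`, marking `4` -/

/-- labels `(0, 5, 1)` on `(D 0, D 1, D 2)`: residues mod `4` are `(0, 1, 1)`, both positive ones `< 2`. -/
def res : Fin 3 → ℕ := ![0, 5, 1]

/-- Label of `H = D 0` is `0`. [folklore] -/
@[simp] theorem res_zero : res 0 = 0 := rfl
/-- Label of `D 1` is `5`. [folklore] -/
@[simp] theorem res_one : res 1 = 5 := rfl
/-- Label of `D 2` is `1`. [folklore] -/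
@[simp] theorem res_two : res 2 = 1 := rfl

/-- ★ the labels are LOW-RESIDUE at `(p, n) = (2, 4)` … -/
theorem res_low (j : Fin 3) : res j = 0 ∨ (0 < res j % 4 ∧ res j % 4 < 2) := by
  revert j; decide

/-- … but NOT coprime-or-zero (T18's clause at `p = 2` fails at `D 1`: `2 ∤ 5` holds, yet the MARKING is `4`, not `2`; and at the
marking, `4 ∤ 5` — the label `5` is neither `0` nor a multiple: the datum is OUTSIDE the «SmallLabels» regime `a < p` too). -/
theorem res_one_facts : ¬ 2 ∣ res 1 ∧ ¬ 4 ∣ res 1 ∧ ¬ res 1 < 2 := by decide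

/-- `fR = x₀⁴ + x₁⁵·x₂`. -/
noncomputable abbrev fR : S := x 0 ^ 4 + x 1 ^ 5 * x 2

/-- the marked ideal `(fR~, 4)` — marking `4 = 2·2`, COMPOSITE. -/
noncomputable def MR : MarkedIdeal Xs := ⟨affineBlowup.idealSheaf (Ideal.span {fR}), [], 4⟩

/-- The ideal of the datum is `(fR)`. [folklore] -/
theorem MR_ideal : MR.ideal = affineBlowup.idealSheaf (Ideal.span {fR}) := rfl

/-- The marking of the datum is `4`. [folklore] -/
theorem MR_mult : MR.mult = 4 := rfl

/-- The frame monomial of the labels `res` is `x₁⁵x₂`. [folklore] -/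
theorem prod_res : ∏ j, x j ^ res j = x 1 ^ 5 * x 2 := by
  simp [Fin.prod_univ_three]

/-- The monomial ideal sheaf of `frame res` is `(x₁⁵x₂)`. [folklore] -/
theorem monomialIdeal_res : monomialIdeal (frame res) = affineBlowup.idealSheaf (Ideal.span {x 1 ^ 5 * x 2}) := by
  rw [monomialIdeal_frame, prod_res]

/-- `∂fR/∂x₂ = x₁⁵` in `S`. [folklore] -/
theorem exists_isDeriv_fR : ∃ δ : S → S, IsDeriv δ ∧ δ fR = x 1 ^ 5 := by
  obtain ⟨δ, hδ, he⟩ := (IsDeriv.of_derivation (MvPolynomial.pderiv (R := ZMod 2) (σ := Fin 3) 2)).exists_extend S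
    (originIdeal (ZMod 2) 3).primeCompl
  refine ⟨δ, hδ, ?_⟩
  have hF : fR = algebraMap P S (MvPolynomial.X 0 ^ 4 + MvPolynomial.X 1 ^ 5 * MvPolynomial.X 2) := by
    simp only [map_add, map_mul, map_pow]
  have h1 : MvPolynomial.pderiv (2 : Fin 3) (MvPolynomial.X 0 ^ 4 : P) = 0 := by
    rw [Derivation.leibniz_pow, MvPolynomial.pderiv_X_of_ne (show (0 : Fin 3) ≠ 2 by decide)]
    simp only [smul_zero]
  have h2 : MvPolynomial.pderiv (2 : Fin 3) (MvPolynomial.X 1 ^ 5 * MvPolynomial.X 2 : P) = MvPolynomial.X 1 ^ 5 := by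
    rw [Derivation.leibniz, MvPolynomial.pderiv_X_self, Derivation.leibniz_pow,
      MvPolynomial.pderiv_X_of_ne (show (1 : Fin 3) ≠ 2 by decide)]
    simp only [smul_eq_mul, mul_one, mul_zero, smul_zero, add_zero]
  have hd : MvPolynomial.pderiv (2 : Fin 3) (MvPolynomial.X 0 ^ 4 + MvPolynomial.X 1 ^ 5 * MvPolynomial.X 2 : P) =
      MvPolynomial.X 1 ^ 5 := by
    rw [map_add, h1, h2, zero_add]
  rw [hF, he, hd, map_pow]

/-- **`Supp(fR~, 4) ⊆ V(x₀)`** — via `∂/∂x₂`: `fR ∈ 𝔪_𝔭⁴ ⊆ 𝔪_𝔭² ⇒ x₁⁵ ∈ 𝔭 ⇒ x₀⁴ = fR − x₁⁵x₂ ∈ 𝔭 ⇒ x₀ ∈ 𝔭`. [folklore] -/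
theorem support_MR_subset : (MR.support : Set Xs) ⊆ H.support := by
  intro p hp
  letI := stalkAlgebra p
  haveI := isLocalizationAtPrime_stalk p
  have hle : stalkIdeal MR.ideal p ≤ maximalIdeal _ ^ 4 := (MarkedIdeal.mem_support_iff MR p).mp hp
  rw [MR_ideal, stalkIdeal_span] at hle
  have hf4 : φ p fR ∈ maximalIdeal _ ^ 4 := hle (Ideal.mem_span_singleton_self _)
  have hf2 : φ p fR ∈ maximalIdeal _ ^ 2 := Ideal.pow_le_pow_right (by norm_num) hf4
  have hf1 : fR ∈ p.asIdeal := (mem_maximalIdeal_iff p fR).mp (Ideal.pow_le_self (by norm_num) hf4)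
  obtain ⟨δ, hδ, hf⟩ := exists_isDeriv_fR
  obtain ⟨δ', hδ', he⟩ := hδ.exists_extend (Xs.presheaf.stalk p) p.asIdeal.primeCompl
  have h15 : x 1 ^ 5 ∈ p.asIdeal := by
    rw [← mem_maximalIdeal_iff p, ← hf, show φ p (δ fR) = algebraMap S _ (δ fR) from rfl, ← he]
    exact hδ'.apply_mem_of_mem_sq _ hf2
  have hx0 : x 0 ^ 4 ∈ p.asIdeal := by
    have := p.asIdeal.sub_mem hf1 (p.asIdeal.mul_mem_right (x 2) h15)
    rwa [add_sub_cancel_right] at this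
  exact (mem_support_D 0 p).mpr (p.2.mem_of_pow_mem 4 hx0)

/-- **the unit-free NC-hyp shape (T17a) of the datum at marking `4`**: `fR = h⁴ + 1·m`, `h = x₀`, `m = x₁⁵x₂`. [new] -/
theorem ncHypShapeF_res : ncHypShapeF 4 Xs (frame res) H MR := by
  refine ⟨rfl, fun q hq hqH => ?_, fun y _ => ?_, support_MR_subset⟩
  · obtain ⟨j, rfl⟩ := (List.mem_ofFn' _ _).mp hq
    have hj : j = 0 := D_injective hqH
    subst hj
    exact Or.inl rfl
  · refine ⟨φ y (x 0), φ y (x 1 ^ 5 * x 2), 1, isUnit_one, stalkIdeal_span _ _, ?_, ?_⟩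
    · rw [monomialIdeal_res, stalkIdeal_span]
    · rw [MR_ideal, stalkIdeal_span, one_mul, ← map_pow, ← map_add]

/-- ★ **THE DATUM IS IN THE LOW-RESIDUE CLASS** `ncHypShapeLow 2 4` (R22a): T17a's shape at marking `4`, `2` prime, `2 ∣ 4`, `2 ≤ 4`,
`2 = 0` in the stalks, and every label in the support of its member is `0` or of residue mod `4` in `(0, 2)` — labels `(0, 5, 1)`.
KERNEL INHABITANT of the class of the cell `WORNCHypWildLow 4` at the COMPOSITE marking `4 = 2·2` (cn41/cn42). [new] -/
theorem ncHypShapeLow_res : ncHypShapeLow 2 4 Xs (frame res) H MR := by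
  refine ⟨ncHypShapeF_res, Nat.prime_two, ⟨2, rfl⟩, by norm_num, two_eq_zero_stalk, fun K y _ => ?_⟩
  by_cases hj : ∃ j, D j = K
  · obtain ⟨j, rfl⟩ := hj
    rw [expOf_frame]
    exact res_low j
  · exact Or.inl (expOf_frame_eq_zero res fun j h => hj ⟨j, h⟩)

/-- **non-degeneracy**: the closed point is a point of order `4` of `fR`, i.e. `pt ∈ Supp(MR)` (`x₀⁴ ∈ 𝔪⁴`, `x₁⁵x₂ = x₁·(x₁⁴·x₂) ∈ 𝔪⁴`). -/
theorem pt_mem_support_MR : pt ∈ MR.support := by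
  rw [MarkedIdeal.mem_support_iff, MR_ideal, stalkIdeal_span, MR_mult, Ideal.span_le, Set.singleton_subset_iff,
    SetLike.mem_coe, maximalIdeal_stalk_eq, pt_asIdeal, ← Ideal.map_pow]
  refine Ideal.mem_map_of_mem _ (Ideal.add_mem _ (Ideal.pow_mem_pow (x_mem 0) 4) ?_)
  rw [show x 1 ^ 5 * x 2 = x 1 * (x 1 ^ 4 * x 2) by ring]
  exact Ideal.mul_mem_left _ _ (Ideal.mul_mem_right _ _ (Ideal.pow_mem_pow (x_mem 1) 4))

/-- ★ **NON-DEGENERACY RECORD**: s.n.c. frame through `H`, `H` a member, the closed point in the support AND on all three members (so the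
low-residue clauses at `D 1` (label `5`) and `D 2` (label `1`) are EXERCISED at `pt`, not escaped through an empty support). [new] -/
theorem res_nondegenerate :
    HasSNC (H :: boundaryOf (frame res)) ∧ H ∈ boundaryOf (frame res) ∧ pt ∈ MR.support ∧
      pt ∈ (D 1).support ∧ pt ∈ (D 2).support ∧ expOf (frame res) (D 1) = 5 ∧ expOf (frame res) (D 2) = 1 :=
  ⟨hasSNC_frame _, H_mem_boundaryOf_frame _, pt_mem_support_MR, pt_mem_support_D 1, pt_mem_support_D 2, expOf_frame res 1,
    expOf_frame res 2⟩

/-- ★★ **A WEAK RESOLUTION OF `x₀⁴ + x₁⁵x₂` AT MARKING `4` IN CHARACTERISTIC `2`, by the low-residue list law (R22a).** [new]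
[cite: Kollar2007, (3.111) Step 3] -/
theorem weakResolution_res : ∃ s : CentreSeq Xs, WeakResolution s MR :=
  ncHypShapeLow_res.exists_weakResolution (hasSNC_frame _) (H_mem_boundaryOf_frame _)

/-! ## cn42 — kernel NON-membership in every previously decided class -/

/-- **NOT in T18's coprime class** at any marking `q` (the class records `MR.mult = q` and `q` prime; `MR.mult = 4`). [new] -/
theorem not_ncHypShapeCop_res (q : ℕ) : ¬ ncHypShapeCop q Xs (frame res) H MR := by
  intro hP
  obtain rfl : 4 = q := hP.toF.mult_eq
  exact absurd hP.prime (by decide)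

/-- **NOT in T19's jet class** at any marking `q`. [new] -/
theorem not_ncHypShapeJet_res (q : ℕ) : ¬ ncHypShapeJet q Xs (frame res) H MR := by
  intro hP
  obtain rfl : 4 = q := hP.toF.mult_eq
  exact absurd hP.prime (by decide)

/-- **NOT in L20's latent class** at any marking `q`, for any latent labelling `L`. [new] -/
theorem not_ncHypShapeLat_res (q : ℕ) (L : List (Xs.IdealSheafData × ℕ)) : ¬ ncHypShapeLat q Xs (frame res) L H MR := by
  intro hP
  obtain rfl : 4 = q := hP.mult_eq
  exact absurd hP.prime (by decide)

/-- **NOT in J21's latent-jet class** at any marking `q`, for any latent labelling `L`. [new] -/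
theorem not_ncHypShapeLatJ_res (q : ℕ) (L : List (Xs.IdealSheafData × ℕ)) : ¬ ncHypShapeLatJ q Xs (frame res) L H MR := by
  intro hP
  obtain rfl : 4 = q := hP.mult_eq
  exact absurd hP.prime (by decide)

/-- **NOT in the low-residue class at a PRIME marking** (any `p`): the class lives here only at the composite marking `4`. [new] -/
theorem not_ncHypShapeLow_res_of_prime {q : ℕ} (hq : q.Prime) (p : ℕ) : ¬ ncHypShapeLow p q Xs (frame res) H MR := by
  intro hP
  obtain rfl : 4 = q := hP.toF.mult_eq
  exact absurd hq (by decide)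

/-- `4 = 0` in every stalk (`4 = 2·2`). [folklore] -/
theorem four_eq_zero_stalk (y : Xs) : ((4 : ℕ) : Xs.presheaf.stalk y) = 0 := by
  rw [show (4 : ℕ) = 2 * 2 from rfl, Nat.cast_mul, two_eq_zero_stalk, mul_zero]

/-- **NOT in T10's tame class** at the marking (`ncHypShape 4` needs `4` a unit in the stalks; `4 = 0` there). [new] -/
theorem not_ncHypShape_res : ¬ ncHypShape 4 Xs (frame res) H MR := fun hP =>
  not_isUnit_zero ((four_eq_zero_stalk pt) ▸ hP.isUnit_natCast pt)

end JetModel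

end Summit.ResolutionOfSingularities.ResolutionOfSingularities.Theorems.DeltaCutClasses
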